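import Literature.RingTheory.CompleteLocalRings.DualNumberPoints
import Mathlib.RingTheory.Ideal.Quotient.Operations
import Mathlib.RingTheory.Ideal.Quotient.Noetherian
import HarnessLib

/-!
# `k[ε]`-points of an augmented `Λ`-algebra: `#t_R = #k ^ μ(𝔪 of R/𝔪_Λ R)`
# (Mazur §15, relative case; Böckle Thm. 2.2 (a))

Topic `Literature/RingTheory/CompleteLocalRings`.  Let `Λ → k` be a surjection onto a field
(kernel `𝔭`, e.g. the residue map of a coefficient ring `𝒪 → k`), `R` a `Λ`-algebra with an
augmentation `π : R →ₐ[Λ] k`, and `R̄ = R/𝔭R`.  Mazur's **tangent space**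
`t_R = {φ : R →ₐ[Λ] k[ε] | φ ≡ π mod ε}` of `(R, π)` ("`t_R = Hom_Λ(R, k[ε])`", [Maz97, §15];
Böckle [Böc07, p. 26 and Thm. 2.2 (a)]: "`t_R ≅ Hom_k(𝔪_R/(𝔪_R² + 𝔪_𝒪 R), k)`") only sees `R̄`,
which is an augmented `k`-algebra; this file performs that reduction and deduces, from the
field case (`DualNumberPoints.lean`), the COUNT

* `RelTangentHom.natCard_eq_pow_spanFinrank` — for `k` finite and `R` local Noetherian:
  `#t_R = #k ^ μ(𝔪_{R̄})`, `μ(𝔪_{R̄})` the minimal number of generators of the maximal ideal of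
  `R̄ = R/𝔭R`, i.e. `dim_k t_R = dim_k 𝔪_R/(𝔪_R² + 𝔭R)` — the number of variables of the
  cotangent presentation `Λ⟦X₁, …, X_h⟧ ↠ R` of `CotangentPresentation.lean`.

Ingredients (all proved): the `k`-algebra structure `quotAlgebra` on `R̄` (`k = Λ/𝔭 → R/𝔭R`),
the induced augmentation `quotAugmentation : R̄ →ₐ[k] k`, and the bijection
`RelTangentHom.equivTangentHom : t_R ≃ t_{R̄}` (a `Λ`-map `R → k[ε]` kills `𝔭R`; a `k`-map out
of `R̄` is the same as a `Λ`-map).  No named facts.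

## References

* B. Mazur, *An introduction to the deformation theory of Galois representations* (1997), §15.
  [cite: Mazur1997Deformation, §15]
* G. Böckle, *Presentations of universal deformation rings*, LMS LNS 320 (2007), Thm. 2.2 (a).
  [cite: Bockle2007Presentations, Theorem 2.2]
-/

noncomputable section

namespace Literature.RingTheory.CompleteLocalRings

open TrivSqZeroExt DualNumber IsLocalRing

universe u v w

variable {Λ : Type u} [CommRing Λ] {k : Type v} [Field k] [Algebra Λ k]
  {R : Type w} [CommRing R] [Algebra Λ R]

/-- **The tangent space of an augmented `Λ`-algebra** `(R, π : R → k)`: the `Λ`-algebra maps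
`R → k[ε]` lifting `π` (Mazur's `t_R = Hom_Λ(R, k[ε])`). [cite: Mazur1997Deformation, §15] -/
def RelTangentHom (π : R →ₐ[Λ] k) : Type (max v w) :=
  {φ : R →ₐ[Λ] k[ε] // ∀ r, (φ r).fst = π r}

variable (Λ k R) in
/-- The ideal `𝔭R` of `R` generated by the kernel `𝔭` of `Λ → k`. [folklore] -/
def baseIdeal : Ideal R := (RingHom.ker (algebraMap Λ k)).map (algebraMap Λ R)

/-- `𝔭` maps into `𝔭R`. [folklore] -/
theorem algebraMap_mem_baseIdeal {o : Λ} (ho : algebraMap Λ k o = 0) :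
    algebraMap Λ R o ∈ baseIdeal Λ k R :=
  Ideal.mem_map_of_mem _ (RingHom.mem_ker.mpr ho)

/-- A `Λ`-algebra map to a `k`-algebra (through `Λ → k`) kills `𝔭R`. [folklore] -/
theorem baseIdeal_le_ker {B : Type*} [CommRing B] [Algebra Λ B] [Algebra k B]
    [IsScalarTower Λ k B] (f : R →ₐ[Λ] B) : baseIdeal Λ k R ≤ RingHom.ker (f : R →+* B) := by
  rw [baseIdeal, Ideal.map_le_iff_le_comap]
  intro o ho
  rw [Ideal.mem_comap, RingHom.mem_ker, RingHom.coe_coe, AlgHom.commutes,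
    IsScalarTower.algebraMap_apply Λ k B, RingHom.mem_ker.mp ho, map_zero]

section QuotAlgebra

variable (R) (hk : Function.Surjective (algebraMap Λ k))

/-- The ring map `k = Λ/𝔭 → R/𝔭R`. [folklore] -/
def toQuot : k →+* R ⧸ baseIdeal Λ k R :=
  (algebraMap Λ k).liftOfSurjective hk
    ⟨(Ideal.Quotient.mk (baseIdeal Λ k R)).comp (algebraMap Λ R), fun o ho => by
      rw [RingHom.mem_ker, RingHom.comp_apply, Ideal.Quotient.eq_zero_iff_mem]
      exact algebraMap_mem_baseIdeal (RingHom.mem_ker.mp ho)⟩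

/-- `toQuot (ō) = [o]`. [folklore] -/
theorem toQuot_algebraMap (o : Λ) :
    toQuot R hk (algebraMap Λ k o) = Ideal.Quotient.mk (baseIdeal Λ k R) (algebraMap Λ R o) :=
  (algebraMap Λ k).liftOfSurjective_comp_apply hk _ o

/-- **The `k`-algebra structure on `R̄ = R/𝔭R`.** [folklore] -/
abbrev quotAlgebra : Algebra k (R ⧸ baseIdeal Λ k R) := (toQuot R hk).toAlgebra

/-- `Λ → k → R̄` is `Λ → R → R̄`. [folklore] -/
theorem isScalarTower_quot :
    letI := quotAlgebra R hk
    IsScalarTower Λ k (R ⧸ baseIdeal Λ k R) := by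
  letI := quotAlgebra R hk
  refine IsScalarTower.of_algebraMap_eq fun o => ?_
  change _ = toQuot R hk (algebraMap Λ k o)
  rw [toQuot_algebraMap]
  rfl

end QuotAlgebra

namespace RelTangentHom

section Quot

variable (hk : Function.Surjective (algebraMap Λ k)) (π : R →ₐ[Λ] k)

/-- **The induced augmentation `π̄ : R̄ →ₐ[k] k`** of `R̄ = R/𝔭R`. [folklore] -/
def quotAugmentation :
    letI := quotAlgebra R hk
    (R ⧸ baseIdeal Λ k R) →ₐ[k] k :=
  letI := quotAlgebra R hk
  { Ideal.Quotient.lift (baseIdeal Λ k R) (π : R →+* k) (fun r hr => baseIdeal_le_ker π hr) with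
    commutes' := fun c => by
      obtain ⟨o, rfl⟩ := hk c
      change Ideal.Quotient.lift (baseIdeal Λ k R) (π : R →+* k) _ (toQuot R hk (algebraMap Λ k o)) = _
      rw [toQuot_algebraMap, Ideal.Quotient.lift_mk, RingHom.coe_coe, AlgHom.commutes,
        Algebra.algebraMap_self, RingHom.id_apply] }

/-- `π̄ [r] = π r`. [folklore] -/
theorem quotAugmentation_mk (r : R) :
    letI := quotAlgebra R hk
    quotAugmentation hk π (Ideal.Quotient.mk _ r) = π r := rfl

/-- **A tangent vector of `R` factors through `R̄`** as a `k`-algebra map.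
[cite: Mazur1997Deformation, §15] -/
def quotMap (φ : RelTangentHom π) :
    letI := quotAlgebra R hk
    (R ⧸ baseIdeal Λ k R) →ₐ[k] k[ε] :=
  letI := quotAlgebra R hk
  { Ideal.Quotient.lift (baseIdeal Λ k R) (φ.1 : R →+* k[ε]) (fun r hr => baseIdeal_le_ker φ.1 hr)
    with
    commutes' := fun c => by
      obtain ⟨o, rfl⟩ := hk c
      change Ideal.Quotient.lift (baseIdeal Λ k R) (φ.1 : R →+* k[ε]) _
        (toQuot R hk (algebraMap Λ k o)) = _
      rw [toQuot_algebraMap, Ideal.Quotient.lift_mk, RingHom.coe_coe, AlgHom.commutes,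
        IsScalarTower.algebraMap_apply Λ k k[ε]] }

/-- `quotMap φ [r] = φ r`. [folklore] -/
theorem quotMap_mk (φ : RelTangentHom π) (r : R) :
    letI := quotAlgebra R hk
    quotMap hk π φ (Ideal.Quotient.mk _ r) = φ.1 r := rfl

/-- **`t_R ≃ t_{R̄}`**: tangent vectors of the augmented `Λ`-algebra `(R, π)` are the same as
tangent vectors of the augmented `k`-algebra `(R̄, π̄)`. [cite: Mazur1997Deformation, §15] -/
def equivTangentHom :
    letI := quotAlgebra R hk
    RelTangentHom π ≃ TangentHom (quotAugmentation hk π) :=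
  letI := quotAlgebra R hk
  haveI := isScalarTower_quot R hk
  { toFun := fun φ => ⟨quotMap hk π φ, fun x => by
      obtain ⟨r, rfl⟩ := Ideal.Quotient.mk_surjective x
      rw [quotMap_mk, quotAugmentation_mk, φ.2]⟩
    invFun := fun ψ => ⟨(ψ.1.restrictScalars Λ).comp (Ideal.Quotient.mkₐ Λ (baseIdeal Λ k R)),
      fun r => by
        change (ψ.1 (Ideal.Quotient.mk _ r)).fst = π r
        rw [ψ.2, quotAugmentation_mk]⟩
    left_inv := fun φ => by
      refine Subtype.ext (AlgHom.ext fun r => ?_)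
      rfl
    right_inv := fun ψ => by
      refine Subtype.ext (AlgHom.ext fun x => ?_)
      obtain ⟨r, rfl⟩ := Ideal.Quotient.mk_surjective x
      rfl }

end Quot

/-- `𝔭R ⊆ ker π ⊆ 𝔪_R`: the quotient `R̄` of a local `R` is local and Noetherian if `R` is.
[folklore] -/
theorem baseIdeal_le_maximalIdeal [IsLocalRing R] (π : R →ₐ[Λ] k) :
    baseIdeal Λ k R ≤ maximalIdeal R :=
  (baseIdeal_le_ker π).trans (IsLocalRing.le_maximalIdeal (RingHom.ker_ne_top _))

/-- `R̄` is nontrivial (for `R` local with an augmentation). [folklore] -/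
theorem nontrivial_quot [IsLocalRing R] (π : R →ₐ[Λ] k) : Nontrivial (R ⧸ baseIdeal Λ k R) :=
  Ideal.Quotient.nontrivial_iff.mpr (ne_top_of_le_ne_top (maximalIdeal.isMaximal R).ne_top
    (baseIdeal_le_maximalIdeal π))

/-- `R̄` is local (for `R` local with an augmentation). [folklore] -/
theorem isLocalRing_quot [IsLocalRing R] (π : R →ₐ[Λ] k) : IsLocalRing (R ⧸ baseIdeal Λ k R) :=
  haveI := nontrivial_quot π
  IsLocalRing.of_surjective' (Ideal.Quotient.mk _) Ideal.Quotient.mk_surjective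

/-- **`#t_R = #k ^ μ(𝔪_{R/𝔭R})`** (Mazur §15; Böckle Thm. 2.2 (a), counted): for `Λ → k` onto a
finite field, `R` a local Noetherian `Λ`-algebra with augmentation `π : R → k`, the number of
`Λ`-algebra maps `R → k[ε]` lifting `π` is `#k` to the minimal number of generators of the
maximal ideal of `R̄ = R/𝔭R` (`= dim_k 𝔪_R/(𝔪_R² + 𝔭R)`, the relative cotangent dimension; the
exponent is the number of variables of the cotangent presentation of
`CotangentPresentation.lean`). [cite: Mazur1997Deformation, §15] [cite: Bockle2007Presentations, Theorem 2.2] -/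
theorem natCard_eq_pow_spanFinrank [Finite k] [IsLocalRing R] [IsNoetherianRing R]
    (hk : Function.Surjective (algebraMap Λ k)) (π : R →ₐ[Λ] k) :
    Nat.card (RelTangentHom π) = Nat.card k ^
      ((maximalIdeal R).map (Ideal.Quotient.mk (baseIdeal Λ k R))).spanFinrank := by
  letI := quotAlgebra R hk
  haveI := isLocalRing_quot π (Λ := Λ) (k := k)
  haveI : IsNoetherianRing (R ⧸ baseIdeal Λ k R) := inferInstance
  rw [Nat.card_congr (equivTangentHom hk π), TangentHom.natCard_eq_pow_spanFinrank,
    IsLocalRing.map_maximalIdeal_of_surjective _ Ideal.Quotient.mk_surjective]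

end RelTangentHom

end Literature.RingTheory.CompleteLocalRings
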